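import Summits.AnomalousDissipation.AnomalousDissipation.Theorems.ScalarAnomalySteadySourceFormal.Negative.ColdStartCeiling
import Summits.AnomalousDissipation.AnomalousDissipation.Theorems.ScalarAnomalySteadySourceFormal.Negative.ScalarTimeShift
import HarnessLib

/-!
# Candidate proof of `stub_inputPowerFloor` (S3 of line `budgeted-mixer-template`,
crux `TwoAndHalfD.ScalarAnomalySteadySourceFormal`, stmt-AnomalousDissipation-0448)

drefute seat — NOT landed by the refuter (stubs are the lead's to land); attached as item
evidence. Registered stub signature VERBATIM (skeleton sha 7c4ef97a32c5). Proof = the line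
card's route: split `θ = φ + ρ` on `[t - nτ, t]` (release of `θ(t-nτ) ∈ S` + cold start), (Floor)
on `ρ`, iterated (Half) along (Inv-0) on `φ`, Cauchy–Schwarz and (small).
-/

open MeasureTheory Set Filter
open _root_.Topology
open scoped InnerProductSpace

noncomputable section

namespace Summit.AnomalousDissipation.AnomalousDissipation.Theorems.ScalarAnomalySteadySourceFormal.Negative

open Literature.Analysis Literature.Analysis.FunctionSpaces Literature.Analysis.FunctionSpaces.Torus
open Literature.Analysis.FluidPDE Literature.Analysis.FluidPDE.Torus

set_option linter.dupNamespace false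

variable {d : Type*} [Fintype d] [DecidableEq d]

omit [DecidableEq d] in
/-- Lower Cauchy–Schwarz: `-√‖h‖² √‖φ‖² ≤ ∫ h φ` for smooth slices. [folklore] -/
theorem neg_sqrt_mul_sqrt_le_integral_mul {h φ : UnitAddTorus d → ℝ} (hh : IsSmooth h) (hφ : IsSmooth φ) :
    -(Real.sqrt (scalarL2Sq h) * Real.sqrt (scalarL2Sq φ)) ≤ ∫ x, h x * φ x := by
  have hneg : IsSmooth (fun x => -φ x) := hφ.neg
  have hcs := integral_mul_le_sqrt_scalarL2Sq hh hneg
  have hsq : scalarL2Sq (fun x => -φ x) = scalarL2Sq φ := by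
    simp only [scalarL2Sq, neg_sq]
  rw [hsq] at hcs
  have hint : ∫ x, h x * (fun x => -φ x) x = -∫ x, h x * φ x := by
    rw [← integral_neg]
    refine integral_congr_ae (ae_of_all _ fun x => ?_)
    simp only [mul_neg]
  rw [hint] at hcs
  linarith

/-- **`stub_inputPowerFloor` (S3) — candidate proof, registered signature verbatim.** [folklore] -/
theorem stub_inputPowerFloor_proof :
    ∀ (κ τ c₀ : ℝ) (n : ℕ) (u : ℝ → UnitAddTorus (Fin 2) → EuclideanSpace ℝ (Fin 2))
      (h : UnitAddTorus (Fin 2) → ℝ) (S : Set (UnitAddTorus (Fin 2) → ℝ))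
      (θ : ℝ → UnitAddTorus (Fin 2) → ℝ),
      0 < κ → 0 < τ → 1 ≤ n →
      Torus.IsSmoothSpaceTimeOn (Set.Ici 0) u → (∀ t ∈ Set.Ici (0 : ℝ), Torus.IsDivFree (u t)) →
      Torus.IsSmooth h →
      4 * τ * Torus.scalarL2Sq h ≤ 2 ^ n * c₀ →
      (∀ (s : ℝ), 0 ≤ s → ∀ φ : ℝ → UnitAddTorus (Fin 2) → ℝ,
          Torus.IsClassicalScalarTransportOn (Set.Icc s (s + τ)) κ u φ → φ s ∈ S →
          Torus.scalarL2Sq (φ (s + τ)) ≤ 4⁻¹ * Torus.scalarL2Sq (φ s)) →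
      (∀ (s T' : ℝ), 0 ≤ s → ∀ φ : ℝ → UnitAddTorus (Fin 2) → ℝ,
          Torus.IsClassicalScalarTransportOn (Set.Icc s T') κ u φ → φ s ∈ S →
          ∀ t ∈ Set.Icc s T', φ t ∈ S) →
      (∀ (s : ℝ), 0 ≤ s → ∀ ρ : ℝ → UnitAddTorus (Fin 2) → ℝ,
          Torus.IsClassicalScalarTransportForcedOn (Set.Icc s (s + n * τ)) κ u (fun _ => h) ρ →
          ρ s = (fun _ => (0 : ℝ)) → c₀ ≤ ∫ x, h x * ρ (s + n * τ) x) →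
      Torus.IsClassicalScalarTransportForcedOn (Set.Ici 0) κ u (fun _ => h) θ →
      (∀ t, 0 ≤ t → θ t ∈ S) →
      (∀ t, 0 ≤ t → Torus.scalarL2Sq (θ t) ≤ 4 * τ ^ 2 * Torus.scalarL2Sq h) →
      ∀ t, n * τ ≤ t → c₀ / 2 ≤ ∫ x, h x * θ t x := by
  intro κ τ c₀ n u h S θ hκ hτ hn hu hdiv hh hsmall hHalf hInv0 hFloor hθ hS hVar t ht
  -- the window `[s, t]`, `s = t - nτ`
  set s : ℝ := t - n * τ with hsdef
  have hn1 : (1 : ℝ) ≤ n := by exact_mod_cast hn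
  have hnτ : τ ≤ (n : ℝ) * τ := by nlinarith
  have hs0 : 0 ≤ s := by simp only [hsdef]; linarith
  have hts : t = s + n * τ := by simp only [hsdef]; ring
  have hlt : s < s + n * τ := by linarith
  have hIcc : Icc s (s + n * τ) ⊆ Ici (0 : ℝ) := fun r hr => le_trans hs0 hr.1
  have hU : UniqueDiffOn ℝ (Icc s (s + n * τ)) := uniqueDiffOn_Icc hlt
  have hθw : IsClassicalScalarTransportForcedOn (Icc s (s + n * τ)) κ u (fun _ => h) θ :=
    forced_restrict_Icc hθ hlt hIcc
  have hθsm : IsSmooth (θ s) := hθ.smooth_scalar.isSmooth_slice (show s ∈ Ici (0:ℝ) from hs0)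
  -- the release `φ` of `θ(s)` over the whole window and the cold start `ρ = θ - φ`
  obtain ⟨φ, hφ, hφ0⟩ := exists_isClassicalScalarTransportOn_Icc hκ hlt (hu.mono hIcc)
    (fun r hr => hdiv r (hIcc hr)) hθsm
  have hφS : φ s ∈ S := by rw [hφ0]; exact hS s hs0
  have hρ : IsClassicalScalarTransportForcedOn (Icc s (s + n * τ)) κ u (fun _ => h)
      (fun r x => θ r x - φ r x) := forced_sub_unforced hU hθw hφ
  have hρ0 : (fun r x => θ r x - φ r x) s = fun _ => 0 := by
    funext x; simp [hφ0]
  have hfloor : c₀ ≤ ∫ x, h x * (θ t x - φ t x) := by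
    have := hFloor s hs0 _ hρ hρ0
    rw [← hts] at this
    simpa using this
  -- iterated halving along (Inv-0)
  have hiter : ∀ k : ℕ, k ≤ n → scalarL2Sq (φ (s + k * τ)) ≤ (4⁻¹ : ℝ) ^ k * scalarL2Sq (θ s) := by
    intro k
    induction k with
    | zero => intro _; simp [hφ0]
    | succ k ih =>
      intro hk
      have hk' : k ≤ n := Nat.le_of_succ_le hk
      have hkR : (k : ℝ) + 1 ≤ n := by exact_mod_cast hk
      have hk0 : (0 : ℝ) ≤ k := Nat.cast_nonneg k
      have hmemS : φ (s + k * τ) ∈ S :=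
        hInv0 s (s + n * τ) hs0 φ hφ hφS (s + k * τ) ⟨by nlinarith, by nlinarith⟩
      have hsub : Icc (s + k * τ) (s + k * τ + τ) ⊆ Icc s (s + n * τ) :=
        Icc_subset_Icc (by nlinarith) (by nlinarith)
      have hφk : IsClassicalScalarTransportOn (Icc (s + k * τ) (s + k * τ + τ)) κ u φ :=
        hφ.restrict_Icc (by linarith) hsub
      have hhalf := hHalf (s + k * τ) (by nlinarith) φ hφk hmemS
      have hcast : s + ((k + 1 : ℕ) : ℝ) * τ = s + k * τ + τ := by push_cast; ring
      rw [hcast]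
      calc scalarL2Sq (φ (s + k * τ + τ)) ≤ 4⁻¹ * scalarL2Sq (φ (s + k * τ)) := hhalf
        _ ≤ 4⁻¹ * ((4⁻¹ : ℝ) ^ k * scalarL2Sq (θ s)) :=
            mul_le_mul_of_nonneg_left (ih hk') (by norm_num)
        _ = (4⁻¹ : ℝ) ^ (k + 1) * scalarL2Sq (θ s) := by rw [pow_succ]; ring
  have hφt : scalarL2Sq (φ t) ≤ (4⁻¹ : ℝ) ^ n * (4 * τ ^ 2 * scalarL2Sq h) := by
    have h1 := hiter n le_rfl
    rw [← hts] at h1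
    exact h1.trans (mul_le_mul_of_nonneg_left (hVar s hs0) (pow_nonneg (by norm_num) n))
  -- arithmetic: `B = 2⁻ⁿ`, `(4⁻¹)ⁿ = B²`, `B·2ⁿ = 1`
  set N : ℝ := Real.sqrt (scalarL2Sq h) with hN
  have hN0 : 0 ≤ N := Real.sqrt_nonneg _
  have hNsq : N ^ 2 = scalarL2Sq h := Real.sq_sqrt (scalarL2Sq_nonneg h)
  set B : ℝ := (2⁻¹ : ℝ) ^ n with hB
  have hB0 : 0 ≤ B := pow_nonneg (by norm_num) n
  have hB4 : (4⁻¹ : ℝ) ^ n = B ^ 2 := by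
    rw [hB, show (4⁻¹ : ℝ) = (2⁻¹) ^ 2 by norm_num, ← pow_mul, ← pow_mul, mul_comm]
  have hB2 : B * 2 ^ n = 1 := by
    rw [hB, ← mul_pow]; norm_num
  have hφt' : scalarL2Sq (φ t) ≤ (B * (2 * τ * N)) ^ 2 := by
    calc scalarL2Sq (φ t) ≤ (4⁻¹ : ℝ) ^ n * (4 * τ ^ 2 * scalarL2Sq h) := hφt
      _ = (B * (2 * τ * N)) ^ 2 := by rw [hB4, ← hNsq]; ring
  have hsqφ : Real.sqrt (scalarL2Sq (φ t)) ≤ B * (2 * τ * N) := by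
    calc Real.sqrt (scalarL2Sq (φ t)) ≤ Real.sqrt ((B * (2 * τ * N)) ^ 2) := Real.sqrt_le_sqrt hφt'
      _ = B * (2 * τ * N) := Real.sqrt_sq (by positivity)
  -- Cauchy–Schwarz from below on `∫ h φ(t)`
  have hφsm : IsSmooth (φ t) := by
    have := hφ.smooth_scalar.isSmooth_slice (show t ∈ Icc s (s + n * τ) from ⟨by linarith, hts.le⟩)
    exact this
  have hθsm' : IsSmooth (θ t) := hθ.smooth_scalar.isSmooth_slice (hIcc ⟨by linarith, hts.le⟩)
  have hcs := neg_sqrt_mul_sqrt_le_integral_mul hh hφsm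
  have hlow : -(2 * τ * B * scalarL2Sq h) ≤ ∫ x, h x * φ t x := by
    have h1 : N * Real.sqrt (scalarL2Sq (φ t)) ≤ N * (B * (2 * τ * N)) :=
      mul_le_mul_of_nonneg_left hsqφ hN0
    have h2 : N * (B * (2 * τ * N)) = 2 * τ * B * scalarL2Sq h := by rw [← hNsq]; ring
    linarith
  -- (small): `2τ B ‖h‖² ≤ c₀ / 2`
  have hsm : 2 * τ * B * scalarL2Sq h ≤ c₀ / 2 := by
    have h1 : B / 2 * (4 * τ * scalarL2Sq h) ≤ B / 2 * (2 ^ n * c₀) :=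
      mul_le_mul_of_nonneg_left hsmall (by positivity)
    have h2 : B / 2 * (2 ^ n * c₀) = c₀ / 2 := by
      calc B / 2 * (2 ^ n * c₀) = (B * 2 ^ n) * c₀ / 2 := by ring
        _ = c₀ / 2 := by rw [hB2]; ring
    linarith
  -- split `∫ h θ(t) = ∫ h (θ - φ)(t) + ∫ h φ(t)`
  have i1 : Integrable (fun x => h x * (θ t x - φ t x)) volume := by
    have := (hh.smul' (hθsm'.sub hφsm)).integrable
    exact this.congr (ae_of_all _ fun x => by simp only [smul_eq_mul, Pi.sub_apply])
  have i2 : Integrable (fun x => h x * φ t x) volume := by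
    have := (hh.smul' hφsm).integrable
    exact this.congr (ae_of_all _ fun x => by simp only [smul_eq_mul])
  have hsplit : ∫ x, h x * θ t x = (∫ x, h x * (θ t x - φ t x)) + ∫ x, h x * φ t x := by
    rw [← integral_add i1 i2]
    refine integral_congr_ae (ae_of_all _ fun x => ?_)
    ring
  rw [hsplit]
  linarith

end Summit.AnomalousDissipation.AnomalousDissipation.Theorems.ScalarAnomalySteadySourceFormal.Negative

end
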